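import Literature.Probability.Percolation.SelfRefinementMeasure
import Literature.Probability.Percolation.KohlerSchindlerTassionRSW
import Summits.CriticalPhenomena.CardyFormulaZ2.Theorems.CardySelfRefinementCriticalPathRSWStubCone2Model
import HarnessLib

/-!
# The self-refinement model `M_2`: section identities of a tuple, locality, the aligned box

Helper file for the stub `stub_cone2` of the line `finite-size-envelope` (crux `CriticalPathRSW`,
route `CardySelfRefinement`), continuing `…StubCone2Model`:

* the six **section identities** (`refinementConfig_insert_selector_insert_shared`, …): fixing the
  selector and shared coin, or the selector and the two own coins, of the tuple `(u, d)` yields the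
  rest configuration `refinementConfig 2 (ω \ T)` (tuple coins `T` removed) with the corresponding
  sub-edges `{a, m}`, `{m, b}` inserted — the dictionary between the coin sections of the signed
  Russo formula and the four bond-level events `B_{x₁x₂}`;
* **interior sections**: the two sections at the own coin of an interior edge are "edge inserted"
  and "edge removed" (`setOf_insert_own_mem_preimage`, `setOf_sdiff_own_mem_preimage`);
* **locality** (`determinedBy_preimage_refinementConfig`): the pull-back of an event determined by
  the pairs of a finite region closed under the coarse-base map is determined by finitely many
  coins;
* the aligned box `[-N, N] × [-M, M]` of `KST2023.box` as a `Finset.Icc`, closed under the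
  coarse-base map (`box_eq_coe_Icc`, `tupleBase_mem_Icc`).

No definitions.
-/

noncomputable section

namespace Summit.CriticalPhenomena.CardyFormulaZ2.Cruxes.CriticalPathRSW.FiniteSizeEnvelope.Cone2

open Literature.Probability.LatticeModels Literature.Probability.Percolation

/-! ### The opening rule of the two sub-edges -/

/-- The opening rule of a sub-edge of the tuple `(u, d)`: (selector on and shared coin on) or
(selector off and own coin on). [folklore] -/
theorem refinementOpen_tupleEdge_iff (u : Site 2) (d : Fin 2) (S : Set (Site 2 × Fin 2 × Fin 3))
    {e : Site 2 × Fin 2} (he : e = (2 * u, d) ∨ e = (2 * u + Pi.single d 1, d)) :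
    RefinementOpen 2 S e ↔ ((u, d, (2 : Fin 3)) ∈ S ∧ (u, d, (1 : Fin 3)) ∈ S) ∨
      ((u, d, (2 : Fin 3)) ∉ S ∧ (e.1, e.2, (0 : Fin 3)) ∈ S) := by
  have hax : IsAxialEdge 2 e ∧ tupleBase 2 e = u ∧ e.2 = d := by
    rcases he with rfl | rfl
    · exact ⟨(isAxialEdge_two_mul u d).1, (isAxialEdge_two_mul u d).2, rfl⟩
    · exact ⟨(isAxialEdge_two_mul_add_single u d).1, (isAxialEdge_two_mul_add_single u d).2, rfl⟩
  rw [refinementOpen_of_isAxialEdge _ hax.1, hax.2.1, hax.2.2]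

/-- **Tuple surgery, set form.** If `S'` agrees with `ω` off the tuple coins and its two sub-edges
have opening values `P₁`, `P₂`, then its configuration is the rest configuration of `ω` with the
sub-edges inserted accordingly. [folklore] -/
theorem refinementConfig_eq_of_sdiff_tupleCoins_eq (u : Site 2) (d : Fin 2)
    {ω S' : Set (Site 2 × Fin 2 × Fin 3)}
    (hSS' : S' \ {(u, d, (2 : Fin 3)), (u, d, (1 : Fin 3)), (2 * u, d, (0 : Fin 3)),
      (2 * u + Pi.single d 1, d, (0 : Fin 3))} =
      ω \ {(u, d, (2 : Fin 3)), (u, d, (1 : Fin 3)), (2 * u, d, (0 : Fin 3)), (2 * u + Pi.single d 1, d, (0 : Fin 3))})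
    {P₁ P₂ : Prop} (h₁ : RefinementOpen 2 S' (2 * u, d) ↔ P₁)
    (h₂ : RefinementOpen 2 S' (2 * u + Pi.single d 1, d) ↔ P₂) :
    refinementConfig 2 S' = {x | x ∈ refinementConfig 2 (ω \ {(u, d, (2 : Fin 3)), (u, d, (1 : Fin 3)),
        (2 * u, d, (0 : Fin 3)), (2 * u + Pi.single d 1, d, (0 : Fin 3))}) ∨
      (x = s(2 * u, 2 * u + Pi.single d 1) ∧ P₁) ∨
      (x = s(2 * u + Pi.single d 1, 2 * u + Pi.single d 1 + Pi.single d 1) ∧ P₂)} := by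
  ext x
  rw [mem_refinementConfig_iff_of_sdiff_tupleCoins_eq u d hSS', h₁, h₂]
  rfl

/-! ### The six section identities -/

/-- Selector on, shared coin on: both sub-edges inserted. [folklore] -/
theorem refinementConfig_insert_selector_insert_shared (u : Site 2) (d : Fin 2)
    (ω : Set (Site 2 × Fin 2 × Fin 3)) :
    refinementConfig 2 (insert (u, d, (2 : Fin 3)) (insert (u, d, (1 : Fin 3)) ω)) =
      insert s(2 * u, 2 * u + Pi.single d 1) (insert s(2 * u + Pi.single d 1, 2 * u + Pi.single d 1 + Pi.single d 1)
        (refinementConfig 2 (ω \ {(u, d, (2 : Fin 3)), (u, d, (1 : Fin 3)), (2 * u, d, (0 : Fin 3)),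
          (2 * u + Pi.single d 1, d, (0 : Fin 3))}))) := by
  rw [refinementConfig_eq_of_sdiff_tupleCoins_eq u d (ω := ω) (P₁ := True) (P₂ := True)]
  · ext x; simp only [Set.mem_setOf_eq, and_true, Set.mem_insert_iff]; tauto
  · ext i; simp only [Set.mem_sdiff, Set.mem_insert_iff, Set.mem_singleton_iff]; tauto
  · rw [refinementOpen_tupleEdge_iff u d _ (Or.inl rfl)]; simp
  · rw [refinementOpen_tupleEdge_iff u d _ (Or.inr rfl)]; simp

/-- Selector on, shared coin off: no sub-edge. [folklore] -/
theorem refinementConfig_insert_selector_sdiff_shared (u : Site 2) (d : Fin 2)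
    (ω : Set (Site 2 × Fin 2 × Fin 3)) :
    refinementConfig 2 (insert (u, d, (2 : Fin 3)) (ω \ {(u, d, (1 : Fin 3))})) =
      refinementConfig 2 (ω \ {(u, d, (2 : Fin 3)), (u, d, (1 : Fin 3)), (2 * u, d, (0 : Fin 3)),
        (2 * u + Pi.single d 1, d, (0 : Fin 3))}) := by
  rw [refinementConfig_eq_of_sdiff_tupleCoins_eq u d (ω := ω) (P₁ := False) (P₂ := False)]
  · ext x; simp
  · ext i; simp only [Set.mem_sdiff, Set.mem_insert_iff, Set.mem_singleton_iff]; tauto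
  · rw [refinementOpen_tupleEdge_iff u d _ (Or.inl rfl)]; simp
  · rw [refinementOpen_tupleEdge_iff u d _ (Or.inr rfl)]; simp

/-- Selector off, both own coins on: both sub-edges inserted. [folklore] -/
theorem refinementConfig_insert_own_insert_own_sdiff_selector (u : Site 2) (d : Fin 2)
    (ω : Set (Site 2 × Fin 2 × Fin 3)) :
    refinementConfig 2 ((insert (2 * u, d, (0 : Fin 3)) (insert (2 * u + Pi.single d 1, d, (0 : Fin 3)) ω)) \
        {(u, d, (2 : Fin 3))}) =
      insert s(2 * u, 2 * u + Pi.single d 1) (insert s(2 * u + Pi.single d 1, 2 * u + Pi.single d 1 + Pi.single d 1)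
        (refinementConfig 2 (ω \ {(u, d, (2 : Fin 3)), (u, d, (1 : Fin 3)), (2 * u, d, (0 : Fin 3)),
          (2 * u + Pi.single d 1, d, (0 : Fin 3))}))) := by
  rw [refinementConfig_eq_of_sdiff_tupleCoins_eq u d (ω := ω) (P₁ := True) (P₂ := True)]
  · ext x; simp only [Set.mem_setOf_eq, and_true, Set.mem_insert_iff]; tauto
  · ext i; simp only [Set.mem_sdiff, Set.mem_insert_iff, Set.mem_singleton_iff]; tauto
  · rw [refinementOpen_tupleEdge_iff u d _ (Or.inl rfl)]; simp
  · rw [refinementOpen_tupleEdge_iff u d _ (Or.inr rfl)]; simp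

/-- Selector off, first own coin on, second off: first sub-edge inserted. [folklore] -/
theorem refinementConfig_insert_own_sdiff_own_sdiff_selector (u : Site 2) (d : Fin 2)
    (ω : Set (Site 2 × Fin 2 × Fin 3)) :
    refinementConfig 2 ((insert (2 * u, d, (0 : Fin 3)) (ω \ {(2 * u + Pi.single d 1, d, (0 : Fin 3))})) \
        {(u, d, (2 : Fin 3))}) =
      insert s(2 * u, 2 * u + Pi.single d 1)
        (refinementConfig 2 (ω \ {(u, d, (2 : Fin 3)), (u, d, (1 : Fin 3)), (2 * u, d, (0 : Fin 3)),
          (2 * u + Pi.single d 1, d, (0 : Fin 3))})) := by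
  have hne := (tupleCoins_ne u d).2.2.2.2.2
  rw [refinementConfig_eq_of_sdiff_tupleCoins_eq u d (ω := ω) (P₁ := True) (P₂ := False)]
  · ext x; simp only [Set.mem_setOf_eq, and_true, and_false, or_false, Set.mem_insert_iff]; tauto
  · ext i; simp only [Set.mem_sdiff, Set.mem_insert_iff, Set.mem_singleton_iff]; tauto
  · rw [refinementOpen_tupleEdge_iff u d _ (Or.inl rfl)]; simp
  · rw [refinementOpen_tupleEdge_iff u d _ (Or.inr rfl)]; simp [hne.symm]

/-- Selector off, first own coin off, second on: second sub-edge inserted. [folklore] -/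
theorem refinementConfig_insert_own_sdiff_own_sdiff_selector' (u : Site 2) (d : Fin 2)
    (ω : Set (Site 2 × Fin 2 × Fin 3)) :
    refinementConfig 2 (((insert (2 * u + Pi.single d 1, d, (0 : Fin 3)) ω) \ {(2 * u, d, (0 : Fin 3))}) \
        {(u, d, (2 : Fin 3))}) =
      insert s(2 * u + Pi.single d 1, 2 * u + Pi.single d 1 + Pi.single d 1)
        (refinementConfig 2 (ω \ {(u, d, (2 : Fin 3)), (u, d, (1 : Fin 3)), (2 * u, d, (0 : Fin 3)),
          (2 * u + Pi.single d 1, d, (0 : Fin 3))})) := by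
  rw [refinementConfig_eq_of_sdiff_tupleCoins_eq u d (ω := ω) (P₁ := False) (P₂ := True)]
  · ext x; simp only [Set.mem_setOf_eq, and_true, and_false, false_or, Set.mem_insert_iff]; tauto
  · ext i; simp only [Set.mem_sdiff, Set.mem_insert_iff, Set.mem_singleton_iff]; tauto
  · rw [refinementOpen_tupleEdge_iff u d _ (Or.inl rfl)]; simp
  · rw [refinementOpen_tupleEdge_iff u d _ (Or.inr rfl)]; simp

/-- Selector off, both own coins off: no sub-edge. [folklore] -/
theorem refinementConfig_sdiff_own_sdiff_own_sdiff_selector (u : Site 2) (d : Fin 2)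
    (ω : Set (Site 2 × Fin 2 × Fin 3)) :
    refinementConfig 2 (((ω \ {(2 * u + Pi.single d 1, d, (0 : Fin 3))}) \ {(2 * u, d, (0 : Fin 3))}) \
        {(u, d, (2 : Fin 3))}) =
      refinementConfig 2 (ω \ {(u, d, (2 : Fin 3)), (u, d, (1 : Fin 3)), (2 * u, d, (0 : Fin 3)),
        (2 * u + Pi.single d 1, d, (0 : Fin 3))}) := by
  rw [refinementConfig_eq_of_sdiff_tupleCoins_eq u d (ω := ω) (P₁ := False) (P₂ := False)]
  · ext x; simp
  · ext i; simp only [Set.mem_sdiff, Set.mem_insert_iff, Set.mem_singleton_iff]; tauto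
  · rw [refinementOpen_tupleEdge_iff u d _ (Or.inl rfl)]; simp
  · rw [refinementOpen_tupleEdge_iff u d _ (Or.inr rfl)]; simp

/-- Inserting a tuple coin does not change the rest configuration. [folklore] -/
theorem sdiff_tupleCoins_insert_of_mem (u : Site 2) (d : Fin 2) {j : Site 2 × Fin 2 × Fin 3}
    (hj : j ∈ ({(u, d, (2 : Fin 3)), (u, d, (1 : Fin 3)), (2 * u, d, (0 : Fin 3)),
      (2 * u + Pi.single d 1, d, (0 : Fin 3))} : Set (Site 2 × Fin 2 × Fin 3)))
    (ω : Set (Site 2 × Fin 2 × Fin 3)) :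
    (insert j ω) \ {(u, d, (2 : Fin 3)), (u, d, (1 : Fin 3)), (2 * u, d, (0 : Fin 3)),
        (2 * u + Pi.single d 1, d, (0 : Fin 3))} =
      ω \ {(u, d, (2 : Fin 3)), (u, d, (1 : Fin 3)), (2 * u, d, (0 : Fin 3)), (2 * u + Pi.single d 1, d, (0 : Fin 3))} := by
  ext i
  simp only [Set.mem_sdiff, Set.mem_insert_iff]
  constructor
  · rintro ⟨rfl | hi, hi'⟩
    · exact absurd hj hi'
    · exact ⟨hi, hi'⟩
  · rintro ⟨hi, hi'⟩
    exact ⟨Or.inr hi, hi'⟩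

/-- Removing a non-tuple coin commutes with removing the tuple coins. [folklore] -/
theorem sdiff_tupleCoins_sdiff_singleton (u : Site 2) (d : Fin 2) (j : Site 2 × Fin 2 × Fin 3)
    (ω : Set (Site 2 × Fin 2 × Fin 3)) :
    (ω \ {j}) \ {(u, d, (2 : Fin 3)), (u, d, (1 : Fin 3)), (2 * u, d, (0 : Fin 3)),
        (2 * u + Pi.single d 1, d, (0 : Fin 3))} =
      (ω \ {(u, d, (2 : Fin 3)), (u, d, (1 : Fin 3)), (2 * u, d, (0 : Fin 3)), (2 * u + Pi.single d 1, d, (0 : Fin 3))}) \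
        {j} := by
  ext i
  simp only [Set.mem_sdiff, Set.mem_singleton_iff]
  tauto

/-! ### Sections at the own coin of an interior edge -/

/-- The `1`-section at the own coin of an interior edge `f` is "`cornerEdge f` inserted". [folklore] -/
theorem setOf_insert_own_mem_preimage {f : Site 2 × Fin 2} (hf : ¬ IsAxialEdge 2 f)
    (X : Set (BondConfig (Site 2))) :
    {ω : Set (Site 2 × Fin 2 × Fin 3) | insert (f.1, f.2, (0 : Fin 3)) ω ∈ refinementConfig 2 ⁻¹' X} =
      {ω | insert (cornerEdge f) (refinementConfig 2 ω) ∈ X} := by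
  ext ω
  simp only [Set.mem_setOf_eq, Set.mem_preimage, refinementConfig_insert_of_not_isAxialEdge hf]

/-- The `0`-section at the own coin of an interior edge `f` is "`cornerEdge f` removed". [folklore] -/
theorem setOf_sdiff_own_mem_preimage {f : Site 2 × Fin 2} (hf : ¬ IsAxialEdge 2 f)
    (X : Set (BondConfig (Site 2))) :
    {ω : Set (Site 2 × Fin 2 × Fin 3) | ω \ {(f.1, f.2, (0 : Fin 3))} ∈ refinementConfig 2 ⁻¹' X} =
      {ω | refinementConfig 2 ω \ {cornerEdge f} ∈ X} := by
  ext ω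
  simp only [Set.mem_setOf_eq, Set.mem_preimage, refinementConfig_sdiff_of_not_isAxialEdge hf]

/-- For an increasing event, the `0`-section at an interior own coin is contained in the
`1`-section. [folklore] -/
theorem setOf_sdiff_own_subset {f : Site 2 × Fin 2} (hf : ¬ IsAxialEdge 2 f)
    {X : Set (BondConfig (Site 2))} (hX : IsUpperSet X) :
    {ω : Set (Site 2 × Fin 2 × Fin 3) | ω \ {(f.1, f.2, (0 : Fin 3))} ∈ refinementConfig 2 ⁻¹' X} ⊆
      {ω | insert (f.1, f.2, (0 : Fin 3)) ω ∈ refinementConfig 2 ⁻¹' X} := by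
  rw [setOf_insert_own_mem_preimage hf, setOf_sdiff_own_mem_preimage hf]
  intro ω hω
  exact hX (Set.sdiff_subset.trans (Set.subset_insert _ _)) hω

/-! ### Locality -/

/-- **Locality of the configuration map.** If `X` is determined by the pairs of vertices of the
finite region `SB`, closed under the coarse-base map `tupleBase 2`, then its pull-back under
`refinementConfig 2` is determined by the coins `SB × Fin 2 × Fin 3`. [folklore] -/
theorem determinedBy_preimage_refinementConfig (SB : Finset (Site 2))
    (hSB : ∀ v ∈ SB, ∀ d : Fin 2, tupleBase 2 (v, d) ∈ SB) {X : Set (BondConfig (Site 2))}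
    (hX : DeterminedBy X ↑SB.sym2) :
    DeterminedBy (refinementConfig 2 ⁻¹' X) ↑(SB ×ˢ (Finset.univ : Finset (Fin 2 × Fin 3))) := by
  rw [determinedBy_iff] at hX ⊢
  intro ω ω' h
  simp only [Set.mem_preimage]
  have hcoin : ∀ v ∈ SB, ∀ (d : Fin 2) (l : Fin 3), ((v, d, l) ∈ ω ↔ (v, d, l) ∈ ω') := by
    intro v hv d l
    have hK : (v, d, l) ∈ (↑(SB ×ˢ (Finset.univ : Finset (Fin 2 × Fin 3))) : Set (Site 2 × Fin 2 × Fin 3)) := by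
      simp [hv]
    have := Set.ext_iff.1 h (v, d, l)
    simp only [Set.mem_inter_iff, hK, and_true] at this
    exact this
  have key : ∀ x ∈ SB.sym2, x ∈ refinementConfig 2 ω ↔ x ∈ refinementConfig 2 ω' := by
    intro x hx
    by_cases hxe : x ∈ (zdGraph 2).edgeSet
    · obtain ⟨⟨v, d⟩, rfl⟩ := mem_edgeSet_iff_exists_cornerEdge.1 hxe
      have hv : v ∈ SB := Finset.mem_sym2_iff.1 hx v (by simp [cornerEdge])
      rw [cornerEdge_mem_refinementConfig_iff, cornerEdge_mem_refinementConfig_iff]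
      exact LandmarksA.refinementOpen_congr (hcoin v hv d 0) (hcoin _ (hSB v hv d) d 1) (hcoin _ (hSB v hv d) d 2)
    · exact ⟨fun h' => absurd (refinementConfig_subset_edgeSet 2 _ h') hxe,
        fun h' => absurd (refinementConfig_subset_edgeSet 2 _ h') hxe⟩
  refine hX _ _ (Set.ext fun x => ?_)
  simp only [Set.mem_inter_iff, Finset.mem_coe]
  constructor
  · rintro ⟨hx, hs⟩
    exact ⟨(key x hs).1 hx, hs⟩
  · rintro ⟨hx, hs⟩
    exact ⟨(key x hs).2 hx, hs⟩

/-! ### The aligned box -/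

/-- The box `[-N, N] × [-M, M] ∩ ℤ²` of `KST2023.box` is the order interval `Icc (-(N, M)) (N, M)`.
[folklore] -/
theorem box_eq_coe_Icc (N M : ℕ) :
    KST2023.box N M = ↑(Finset.Icc (-(![(N : ℤ), (M : ℤ)] : Site 2)) ![(N : ℤ), (M : ℤ)]) := by
  ext x
  simp only [KST2023.mem_box, Finset.coe_Icc, Set.mem_Icc, Pi.le_def, Fin.forall_fin_two,
    Pi.neg_apply, Matrix.cons_val_zero, Matrix.cons_val_one, Matrix.cons_val_fin_one, abs_le]
  tauto

/-- The box `Icc (-(N, M)) (N, M)` is closed under the coarse-base map `v ↦ ⌊v / 2⌋`. [folklore] -/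
theorem tupleBase_mem_Icc (N M : ℕ) {v : Site 2}
    (hv : v ∈ Finset.Icc (-(![(N : ℤ), (M : ℤ)] : Site 2)) ![(N : ℤ), (M : ℤ)]) (d : Fin 2) :
    tupleBase 2 (v, d) ∈ Finset.Icc (-(![(N : ℤ), (M : ℤ)] : Site 2)) ![(N : ℤ), (M : ℤ)] := by
  simp only [Finset.mem_Icc, Pi.le_def, Fin.forall_fin_two, Pi.neg_apply, Matrix.cons_val_zero,
    Matrix.cons_val_one, Matrix.cons_val_fin_one, tupleBase_apply, Nat.cast_ofNat] at hv ⊢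
  omega

/-- Crossing events of the box are determined by the pairs of its vertices. [folklore] -/
theorem determinedBy_crossing (N M : ℕ) :
    DeterminedBy (KST2023.crossing N M)
      ↑(Finset.Icc (-(![(N : ℤ), (M : ℤ)] : Site 2)) ![(N : ℤ), (M : ℤ)]).sym2 := by
  unfold KST2023.crossing
  rw [box_eq_coe_Icc]
  exact PlanarDuality.determinedBy_openCrossing _ _ _

/-- **The pull-back of the box crossing is a cylinder event of the coins of the box.** [folklore] -/
theorem determinedBy_preimage_crossing (N M : ℕ) :
    DeterminedBy (refinementConfig 2 ⁻¹' KST2023.crossing N M)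
      ↑(Finset.Icc (-(![(N : ℤ), (M : ℤ)] : Site 2)) ![(N : ℤ), (M : ℤ)] ×ˢ
        (Finset.univ : Finset (Fin 2 × Fin 3))) :=
  determinedBy_preimage_refinementConfig _ (fun _ hv d => tupleBase_mem_Icc N M hv d)
    (determinedBy_crossing N M)

end Summit.CriticalPhenomena.CardyFormulaZ2.Cruxes.CriticalPathRSW.FiniteSizeEnvelope.Cone2

namespace Summit.CriticalPhenomena.CardyFormulaZ2.Cruxes.CriticalPathRSW.FiniteSizeEnvelope

open Literature.Probability.LatticeModels Literature.Probability.Percolation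

/-- Registered sub-goal `stub_cone2_locality` of stub `stub_cone2` (line `finite-size-envelope`):
the pull-back of the box crossing `𝓒(N, M)` to the coins of `M_2` is a cylinder event of the coins
of the box (`Cone2.determinedBy_preimage_crossing`). [folklore] -/
theorem stub_cone2_locality :
    ∀ N M : ℕ, DeterminedBy (refinementConfig 2 ⁻¹' KST2023.crossing N M)
      ↑(Finset.Icc (-(![(N : ℤ), (M : ℤ)] : Site 2)) ![(N : ℤ), (M : ℤ)] ×ˢ (Finset.univ : Finset (Fin 2 × Fin 3))) :=
  Cone2.determinedBy_preimage_crossing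

end Summit.CriticalPhenomena.CardyFormulaZ2.Cruxes.CriticalPathRSW.FiniteSizeEnvelope

end
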